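import Literature.AlgebraicGeometry.Smoothening.NeronPropertyCodimOne
import Literature.NumberTheory.EllipticCurves.NeronModelWeilExtension
import Literature.NumberTheory.EllipticCurves.NeronModelExtensionLocal
import Literature.NumberTheory.EllipticCurves.NeronModelExistenceReduction
import HarnessLib

/-!
# A smooth separated group scheme of finite type with the extension property for points is a
# Néron model (BLR 7.1/1 over the base; Artin, Cor. (1.6))

Topic: `Literature/AlgebraicGeometry/Smoothening` (Bosch–Lütkebohmert–Raynaud, *Néron Models*,
Thm. 7.1/1 (criterion for a smooth separated group scheme of finite type to be a Néron model in
terms of points with values in strictly henselian, resp. "index one", discrete valuation rings);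
M. Artin, *Néron Models*, Cor. (1.6) and §3–4). Let `R` be a discrete valuation ring with
uniformizer `ϖ` and fraction field `K`, and `G → Spec R` a smooth separated quasi-compact group
scheme with the **points property**: for every discrete valuation ring `S` over `R` in which
`ϖ` is a uniformizer, with fraction field `L`, every `R`-morphism `Spec L → G` extends to
`Spec S → G`. Then `G` is a Néron model of its generic fibre (`isNeronModel_of_points`):
uniqueness of extensions is schematic density of the generic fibre
(`map_genericFibre_injective_of_smooth`); existence is local on the source
(`bijective_map_of_isAffine`, `exists_map_eq_of_forall_opens`, `openExtension_of_forall_isIntegral`)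
and, for an integral affine smooth source, is Weil's extension theorem
(`weil_extension_of_codimOne`) whose hypothesis — definedness in codimension `≤ 1` — is
`exists_nhds_extension_of_points` (`NeronPropertyCodimOne`). In this form no passage to the
strict henselisation is needed: the test rings are all discrete valuation rings of ramification
index one over `R`, not only the étale ones. The `…separablePoints` versions assume the points
property only for the test rings whose residue field is separable over that of `R` (the form
needed for imperfect residue fields; `exists_nhds_extension_of_separablePoints`).
[folklore]; no named facts (D-0026).

## References

* S. Bosch, W. Lütkebohmert, M. Raynaud, *Néron Models*, Springer 1990, Thm. 7.1/1, §3.6.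
  [BLRNeronModels1990] (Not held; numbers only.)
* M. Artin, *Néron Models*, in Cornell–Silverman (eds.), *Arithmetic Geometry*, Springer 1986,
  Prop. (1.3), Cor. (1.6) (pp. 215–216). [Artin1986NeronModels]
-/

noncomputable section

universe u

open CategoryTheory AlgebraicGeometry IsLocalRing
open Literature.NumberTheory.EllipticCurves
open scoped CategoryTheory.Obj

namespace Literature.AlgebraicGeometry.Smoothening

variable (R : Type u) [CommRing R] [IsDomain R] [IsDiscreteValuationRing R] (K : Type u) [Field K]
  [Algebra R K] [IsFractionRing R K] {ϖ : R} (hϖ : Irreducible ϖ)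

include hϖ in
/-- **Extension of morphisms from smooth schemes into a group scheme with the points property**
(the surjectivity half of the Néron mapping property): `G → Spec R` a separated group scheme
locally of finite type with the points property for `ϖ`, `𝒳 → Spec R` smooth with affine total
space, `U ⊆ X` an open containing the generic fibre, `g : U → G` over `R`; then `g` extends to
`X → G`. [cite: Artin1986NeronModels, Prop. (1.3) and Cor. (1.6) (pp. 215–216)] -/
theorem exists_extension_of_points (𝒢 : Over (Spec (.of R))) [GrpObj 𝒢] [IsSeparated 𝒢.hom]
    [LocallyOfFiniteType 𝒢.hom]
    (hpts : ∀ (S : Type u) [CommRing S] [IsDomain S] [IsDiscreteValuationRing S] [Algebra R S]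
      (L : Type u) [Field L] [Algebra S L] [IsFractionRing S L] [Algebra R L] [IsScalarTower R S L],
      Irreducible (algebraMap R S ϖ) →
        ∀ x : Spec (.of L) ⟶ 𝒢.left, x ≫ 𝒢.hom = Spec.map (CommRingCat.ofHom (algebraMap R L)) →
          ∃ x' : Spec (.of S) ⟶ 𝒢.left,
            Spec.map (CommRingCat.ofHom (algebraMap S L)) ≫ x' = x ∧
              x' ≫ 𝒢.hom = Spec.map (CommRingCat.ofHom (algebraMap R S)))
    (𝒳 : Over (Spec (.of R))) (h𝒳 : Smooth 𝒳.hom) (h𝒳a : IsAffine 𝒳.left) (U : 𝒳.left.Opens)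
    (hU : 𝒳.hom.base ⁻¹' Set.range (specGenericPoint R K).base ⊆ (U : Set 𝒳.left))
    (g : (U : Scheme.{u}) ⟶ 𝒢.left) (hg : g ≫ 𝒢.hom = U.ι ≫ 𝒳.hom) :
    ∃ f : 𝒳.left ⟶ 𝒢.left, f ≫ 𝒢.hom = 𝒳.hom ∧ U.ι ≫ f = g := by
  refine openExtension_of_forall_isIntegral R K 𝒢 (fun 𝒴 h𝒴 h𝒴a h𝒴i V hV g' hg' => ?_)
    𝒳 h𝒳 h𝒳a U hU g hg
  haveI := h𝒴; haveI := h𝒴a; haveI := h𝒴i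
  exact weil_extension_of_codimOne R K 𝒢 𝒴 h𝒴 h𝒴a h𝒴i V hV g' hg'
    fun y hy => exists_nhds_extension_of_points (K := K) hϖ hpts V hV g' hg' y hy

include hϖ in
/-- **A smooth separated quasi-compact group scheme over a discrete valuation ring with the
points property is a Néron model of its generic fibre** (BLR Thm. 7.1/1 in the "index one"
form; Artin, Cor. (1.6)). [cite: Artin1986NeronModels, Cor. (1.6) (pp. 215–216)] -/
theorem isNeronModel_of_points (𝒢 : Over (Spec (.of R))) [GrpObj 𝒢] [Smooth 𝒢.hom]
    [IsSeparated 𝒢.hom] [QuasiCompact 𝒢.hom]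
    (hpts : ∀ (S : Type u) [CommRing S] [IsDomain S] [IsDiscreteValuationRing S] [Algebra R S]
      (L : Type u) [Field L] [Algebra S L] [IsFractionRing S L] [Algebra R L] [IsScalarTower R S L],
      Irreducible (algebraMap R S ϖ) →
        ∀ x : Spec (.of L) ⟶ 𝒢.left, x ≫ 𝒢.hom = Spec.map (CommRingCat.ofHom (algebraMap R L)) →
          ∃ x' : Spec (.of S) ⟶ 𝒢.left,
            Spec.map (CommRingCat.ofHom (algebraMap S L)) ≫ x' = x ∧
              x' ≫ 𝒢.hom = Spec.map (CommRingCat.ofHom (algebraMap R S))) :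
    IsNeronModel R K 𝒢 ((genericFibre R K).obj 𝒢) where
  smooth := ‹_›
  isSeparated := ‹_›
  locallyOfFiniteType := inferInstance
  quasiCompact := ‹_›
  exists_iso := ⟨Iso.refl _, by rw [Iso.refl_hom]; infer_instance⟩
  mappingProperty := by
    haveI : IsOpenImmersion (specGenericPoint R K) := isOpenImmersion_specGenericPoint R K
    refine bijective_map_of_isAffine (specGenericPoint R K) 𝒢 fun 𝒳 h𝒳 h𝒳a => ⟨?_, fun u => ?_⟩
    · exact map_genericFibre_injective_of_smooth R K 𝒢 𝒳 h𝒳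
    · exact exists_map_eq_of_forall_opens R K 𝒢 𝒳
        (fun U hU g hg => exists_extension_of_points R K hϖ 𝒢 hpts 𝒳 h𝒳 h𝒳a U hU g hg) u

omit [IsDomain R] [IsDiscreteValuationRing R] [IsFractionRing R K] in
/-- Transport of the Néron property along an isomorphism of group schemes of the generic fibre:
a Néron model of `E'` is a Néron model of every `E ≅ E'` (as group schemes over `K`).  Duplicate
of `IsNeronModel.of_iso_right` (`NeronModelExistence.lean`), kept as a deprecated alias
(dedup-01329). [folklore] -/
@[deprecated IsNeronModel.of_iso_right (since := "2026-08-16")]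
theorem isNeronModel_of_iso {𝒩 : Over (Spec (.of R))} [GrpObj 𝒩] {E' E : Over (Spec (.of K))}
    [GrpObj E'] [GrpObj E] (h : IsNeronModel R K 𝒩 E') (e : E' ≅ E) [IsMonHom e.hom] :
    IsNeronModel R K 𝒩 E :=
  h.of_iso_right e

include hϖ in
/-- **Néron models from the points property, for a given generic fibre**: a smooth separated
quasi-compact `R`-group scheme `𝒢` with the points property and an isomorphism of group schemes
`𝒢_K ≅ E` is a Néron model of `E`. [cite: Artin1986NeronModels, Cor. (1.6) (pp. 215–216)] -/
theorem isNeronModel_of_points_of_iso (𝒢 : Over (Spec (.of R))) [GrpObj 𝒢] [Smooth 𝒢.hom]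
    [IsSeparated 𝒢.hom] [QuasiCompact 𝒢.hom]
    (hpts : ∀ (S : Type u) [CommRing S] [IsDomain S] [IsDiscreteValuationRing S] [Algebra R S]
      (L : Type u) [Field L] [Algebra S L] [IsFractionRing S L] [Algebra R L] [IsScalarTower R S L],
      Irreducible (algebraMap R S ϖ) →
        ∀ x : Spec (.of L) ⟶ 𝒢.left, x ≫ 𝒢.hom = Spec.map (CommRingCat.ofHom (algebraMap R L)) →
          ∃ x' : Spec (.of S) ⟶ 𝒢.left,
            Spec.map (CommRingCat.ofHom (algebraMap S L)) ≫ x' = x ∧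
              x' ≫ 𝒢.hom = Spec.map (CommRingCat.ofHom (algebraMap R S)))
    {E : Over (Spec (.of K))} [GrpObj E] (e : (genericFibre R K).obj 𝒢 ≅ E) [IsMonHom e.hom] :
    IsNeronModel R K 𝒢 E :=
  (isNeronModel_of_points R K hϖ 𝒢 hpts).of_iso_right e

/-! ### The same with test rings of separable residue field -/

include hϖ in
/-- `exists_extension_of_points` assuming the points property only for the test rings whose
residue field is separable over that of `R`. [cite: Artin1986NeronModels, Prop. (1.3) and Cor. (1.6) (pp. 215–216)] -/
theorem exists_extension_of_separablePoints (𝒢 : Over (Spec (.of R))) [GrpObj 𝒢] [IsSeparated 𝒢.hom]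
    [LocallyOfFiniteType 𝒢.hom]
    (hpts : ∀ (S : Type u) [CommRing S] [IsDomain S] [IsDiscreteValuationRing S] [Algebra R S]
      (L : Type u) [Field L] [Algebra S L] [IsFractionRing S L] [Algebra R L] [IsScalarTower R S L],
      Irreducible (algebraMap R S ϖ) →
        (∀ [IsLocalHom (algebraMap R S)], (ResidueField.map (algebraMap R S)).FormallySmooth) →
        ∀ x : Spec (.of L) ⟶ 𝒢.left, x ≫ 𝒢.hom = Spec.map (CommRingCat.ofHom (algebraMap R L)) →
          ∃ x' : Spec (.of S) ⟶ 𝒢.left,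
            Spec.map (CommRingCat.ofHom (algebraMap S L)) ≫ x' = x ∧
              x' ≫ 𝒢.hom = Spec.map (CommRingCat.ofHom (algebraMap R S)))
    (𝒳 : Over (Spec (.of R))) (h𝒳 : Smooth 𝒳.hom) (h𝒳a : IsAffine 𝒳.left) (U : 𝒳.left.Opens)
    (hU : 𝒳.hom.base ⁻¹' Set.range (specGenericPoint R K).base ⊆ (U : Set 𝒳.left))
    (g : (U : Scheme.{u}) ⟶ 𝒢.left) (hg : g ≫ 𝒢.hom = U.ι ≫ 𝒳.hom) :
    ∃ f : 𝒳.left ⟶ 𝒢.left, f ≫ 𝒢.hom = 𝒳.hom ∧ U.ι ≫ f = g := by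
  refine openExtension_of_forall_isIntegral R K 𝒢 (fun 𝒴 h𝒴 h𝒴a h𝒴i V hV g' hg' => ?_)
    𝒳 h𝒳 h𝒳a U hU g hg
  haveI := h𝒴; haveI := h𝒴a; haveI := h𝒴i
  exact weil_extension_of_codimOne R K 𝒢 𝒴 h𝒴 h𝒴a h𝒴i V hV g' hg'
    fun y hy => exists_nhds_extension_of_separablePoints (K := K) hϖ hpts V hV g' hg' y hy

include hϖ in
/-- **A smooth separated quasi-compact group scheme over a discrete valuation ring with the
points property for the test rings of ramification index one (uniformizer `ϖ`, separable
residue field) is a Néron model of its generic fibre.**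
[cite: Artin1986NeronModels, Cor. (1.6) (pp. 215–216)] -/
theorem isNeronModel_of_separablePoints (𝒢 : Over (Spec (.of R))) [GrpObj 𝒢] [Smooth 𝒢.hom]
    [IsSeparated 𝒢.hom] [QuasiCompact 𝒢.hom]
    (hpts : ∀ (S : Type u) [CommRing S] [IsDomain S] [IsDiscreteValuationRing S] [Algebra R S]
      (L : Type u) [Field L] [Algebra S L] [IsFractionRing S L] [Algebra R L] [IsScalarTower R S L],
      Irreducible (algebraMap R S ϖ) →
        (∀ [IsLocalHom (algebraMap R S)], (ResidueField.map (algebraMap R S)).FormallySmooth) →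
        ∀ x : Spec (.of L) ⟶ 𝒢.left, x ≫ 𝒢.hom = Spec.map (CommRingCat.ofHom (algebraMap R L)) →
          ∃ x' : Spec (.of S) ⟶ 𝒢.left,
            Spec.map (CommRingCat.ofHom (algebraMap S L)) ≫ x' = x ∧
              x' ≫ 𝒢.hom = Spec.map (CommRingCat.ofHom (algebraMap R S))) :
    IsNeronModel R K 𝒢 ((genericFibre R K).obj 𝒢) where
  smooth := ‹_›
  isSeparated := ‹_›
  locallyOfFiniteType := inferInstance
  quasiCompact := ‹_›
  exists_iso := ⟨Iso.refl _, by rw [Iso.refl_hom]; infer_instance⟩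
  mappingProperty := by
    haveI : IsOpenImmersion (specGenericPoint R K) := isOpenImmersion_specGenericPoint R K
    refine bijective_map_of_isAffine (specGenericPoint R K) 𝒢 fun 𝒳 h𝒳 h𝒳a => ⟨?_, fun u => ?_⟩
    · exact map_genericFibre_injective_of_smooth R K 𝒢 𝒳 h𝒳
    · exact exists_map_eq_of_forall_opens R K 𝒢 𝒳
        (fun U hU g hg => exists_extension_of_separablePoints R K hϖ 𝒢 hpts 𝒳 h𝒳 h𝒳a U hU g hg) u

include hϖ in
/-- … and, given an isomorphism of group schemes `𝒢_K ≅ E`, a Néron model of `E`.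
[cite: Artin1986NeronModels, Cor. (1.6) (pp. 215–216)] -/
theorem isNeronModel_of_separablePoints_of_iso (𝒢 : Over (Spec (.of R))) [GrpObj 𝒢] [Smooth 𝒢.hom]
    [IsSeparated 𝒢.hom] [QuasiCompact 𝒢.hom]
    (hpts : ∀ (S : Type u) [CommRing S] [IsDomain S] [IsDiscreteValuationRing S] [Algebra R S]
      (L : Type u) [Field L] [Algebra S L] [IsFractionRing S L] [Algebra R L] [IsScalarTower R S L],
      Irreducible (algebraMap R S ϖ) →
        (∀ [IsLocalHom (algebraMap R S)], (ResidueField.map (algebraMap R S)).FormallySmooth) →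
        ∀ x : Spec (.of L) ⟶ 𝒢.left, x ≫ 𝒢.hom = Spec.map (CommRingCat.ofHom (algebraMap R L)) →
          ∃ x' : Spec (.of S) ⟶ 𝒢.left,
            Spec.map (CommRingCat.ofHom (algebraMap S L)) ≫ x' = x ∧
              x' ≫ 𝒢.hom = Spec.map (CommRingCat.ofHom (algebraMap R S)))
    {E : Over (Spec (.of K))} [GrpObj E] (e : (genericFibre R K).obj 𝒢 ≅ E) [IsMonHom e.hom] :
    IsNeronModel R K 𝒢 E :=
  (isNeronModel_of_separablePoints R K hϖ 𝒢 hpts).of_iso_right e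

/-! ### The existence of Néron models over a discrete valuation ring, reduced to the construction
of a group scheme with the points property -/

/-- **What remains of the existence theorem over a discrete valuation ring** (BLR Cor. 1.3/2 via
4.3–4.4 and 5.1; Artin §3): if for every abelian variety `E` over `K` (proper geometrically
integral group scheme) there is a smooth separated quasi-compact `R`-group scheme `𝒢` with an
isomorphism of group schemes `𝒢_K ≅ E` and the points property for the test rings of
ramification index one, then `exists_isNeronModel R K` holds. (The hypothesis is what the
birational group law on the `ω`-minimal components of a weak Néron model — `WeakNeronModelPoints`
— and Weil's theorem produce.) [cite: Artin1986NeronModels, Lemma (3.2) and its proof (pp. 223–224)] -/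
theorem exists_isNeronModel_of_forall_exists_points {ϖ : R} (hϖ : Irreducible ϖ)
    (H : ∀ (E : Over (Spec (.of K))) [GrpObj E] [IsProper E.hom] [GeometricallyIntegral E.hom],
      ∃ (𝒢 : Over (Spec (.of R))) (_ : GrpObj 𝒢) (_ : Smooth 𝒢.hom) (_ : IsSeparated 𝒢.hom)
        (_ : QuasiCompact 𝒢.hom) (e : (genericFibre R K).obj 𝒢 ≅ E) (_ : IsMonHom e.hom),
        ∀ (S : Type u) [CommRing S] [IsDomain S] [IsDiscreteValuationRing S] [Algebra R S]
          (L : Type u) [Field L] [Algebra S L] [IsFractionRing S L] [Algebra R L] [IsScalarTower R S L],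
          Irreducible (algebraMap R S ϖ) →
            (∀ [IsLocalHom (algebraMap R S)], (ResidueField.map (algebraMap R S)).FormallySmooth) →
            ∀ x : Spec (.of L) ⟶ 𝒢.left, x ≫ 𝒢.hom = Spec.map (CommRingCat.ofHom (algebraMap R L)) →
              ∃ x' : Spec (.of S) ⟶ 𝒢.left,
                Spec.map (CommRingCat.ofHom (algebraMap S L)) ≫ x' = x ∧
                  x' ≫ 𝒢.hom = Spec.map (CommRingCat.ofHom (algebraMap R S))) :
    exists_isNeronModel R K := by
  intro E _ _ _
  obtain ⟨𝒢, _, _, _, _, e, _, hpts⟩ := H E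
  exact ⟨⟨𝒢⟩, isNeronModel_of_separablePoints_of_iso R K hϖ 𝒢 hpts e⟩

/-- **The existence of Néron models over Dedekind domains (`exists_isNeronModel`, BLR Cor. 1.3/2
and Thm. 1.4/3) reduced to the group-scheme construction over discrete valuation rings**: if over
every discrete valuation ring with chosen uniformizer every abelian variety has a smooth
separated quasi-compact group model with the index-one points property, then Néron models exist
over every Dedekind domain (`exists_isNeronModel_of_forall_exists_points` and the reduction to
the local case `Literature.NumberTheory.EllipticCurves.exists_isNeronModel_of_dvr`).
[cite: Artin1986NeronModels, Lemma (3.2) and its proof (pp. 223–224)] -/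
theorem exists_isNeronModel_of_forall_dvr_exists_points
    (H : ∀ (R : Type u) [CommRing R] [IsDomain R] [IsDiscreteValuationRing R] (K : Type u) [Field K]
      [Algebra R K] [IsFractionRing R K] (ϖ : R), Irreducible ϖ →
      ∀ (E : Over (Spec (.of K))) [GrpObj E] [IsProper E.hom] [GeometricallyIntegral E.hom],
      ∃ (𝒢 : Over (Spec (.of R))) (_ : GrpObj 𝒢) (_ : Smooth 𝒢.hom) (_ : IsSeparated 𝒢.hom)
        (_ : QuasiCompact 𝒢.hom) (e : (genericFibre R K).obj 𝒢 ≅ E) (_ : IsMonHom e.hom),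
        ∀ (S : Type u) [CommRing S] [IsDomain S] [IsDiscreteValuationRing S] [Algebra R S]
          (L : Type u) [Field L] [Algebra S L] [IsFractionRing S L] [Algebra R L] [IsScalarTower R S L],
          Irreducible (algebraMap R S ϖ) →
            (∀ [IsLocalHom (algebraMap R S)], (ResidueField.map (algebraMap R S)).FormallySmooth) →
            ∀ x : Spec (.of L) ⟶ 𝒢.left, x ≫ 𝒢.hom = Spec.map (CommRingCat.ofHom (algebraMap R L)) →
              ∃ x' : Spec (.of S) ⟶ 𝒢.left,
                Spec.map (CommRingCat.ofHom (algebraMap S L)) ≫ x' = x ∧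
                  x' ≫ 𝒢.hom = Spec.map (CommRingCat.ofHom (algebraMap R S)))
    (R₀ : Type u) [CommRing R₀] [IsDedekindDomain R₀] (K₀ : Type u) [Field K₀] [Algebra R₀ K₀]
    [IsFractionRing R₀ K₀] : exists_isNeronModel R₀ K₀ := by
  refine exists_isNeronModel_of_dvr (fun R _ _ _ K _ _ _ => ?_) R₀ K₀
  obtain ⟨ϖ, hϖ⟩ := IsDiscreteValuationRing.exists_irreducible R
  exact exists_isNeronModel_of_forall_exists_points R K hϖ (fun E _ _ _ => H R K ϖ hϖ E)

end Literature.AlgebraicGeometry.Smoothening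

end
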